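import Literature.NumberTheory.GaloisRepresentations.LocalClassFieldAxiom
import Literature.NumberTheory.GaloisRepresentations.LocalFieldFiniteExtension
import Literature.NumberTheory.GaloisRepresentations.LocalReciprocityLawDischargeProofs
import Literature.NumberTheory.GaloisRepresentations.GlobalArtinMapAbstractExtensionProofs
import Literature.Algebra.Homology.CyclicExtensionUnitsCohomology
import Literature.Algebra.Homology.TateTheorem
import Mathlib.RepresentationTheory.Homological.GroupCohomology.Functoriality
import HarnessLib

/-!
# Every CYCLIC layer `(Gal(L/K), Lˣ)` of a non-archimedean local field is a CLASS MODULE: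
# `H¹(U, Lˣ) = 0`, `|H²(U, Lˣ)| = |U|` for every `U ≤ Gal(L/K)`, `H²(Gal(L/K), Lˣ)` cyclic, hence
# `IsClassModule` and Tate's theorem `Ĥⁿ(U, ℤ) ≅ Ĥⁿ⁺²(U, Lˣ)` — in Mathlib's `groupCohomology`
# (Serre, *Local Fields* XIII §3–§4; Neukirch, *Bonn Lectures* I §7 (7.3), II §5 (5.1))

Topic `NumberTheory/GaloisRepresentations` (local class field theory); namespace
`Literature.NumberTheory.GaloisRepresentations.UnitsLayer`.  Proof file: theorems only (no
definition, no named fact, no instance, no notation, no `sorry`; D-0026).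

The local twin of `Automorphic/IdeleClassGroupCyclicLayerClassModule` (the idèle class group of a
cyclic extension of number fields is a class module): for a finite Galois extension `L/K` of
fields the `Gal(L/K)`-module `Lˣ` is Mathlib's `Rep.ofAlgebraAutOnUnits K L : Rep ℤ (L ≃ₐ[K] L)`
(on `Additive Lˣ`), and the engine `Literature/Algebra/Homology` supplies `IsClassModule`, Tate's
theorem (`TateTheorem`) and, for cyclic groups, `CyclicExtension.H2UnitsIso :
H²(Gal(L/K), Lˣ) ≅ Kˣ/N_{L/K}Lˣ`.  This file feeds it the ARITHMETIC of local fields already in the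
tree: the local class field axiom `(Kˣ : N_{L/K} Lˣ) = [L:K]` for cyclic layers
(`index_range_unitsMap_norm_eq_finrank`, Neukirch ANT V (1.1)), the local structure on every
intermediate field (`FiniteExtension.isNonarchimedeanLocalField`), and the local reciprocity law
(`localReciprocityLaw_holds`: `Kˣ/N Lˣ ≅ Gal(L/K)`) for the cyclicity of `H²`.

* §1 (any fields, `L/K` finite Galois) `nonempty_groupCohomology_res_iso_fixedField` (`Hⁿ(U, Res_U Lˣ)
  ≅ Hⁿ(Gal(L/L^U), Lˣ)`: the restriction to `U ≤ Gal(L/K)` IS the layer `L/L^U`),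
  **`isZero_H1_res_units`** (axiom I for every subgroup: Hilbert 90, Mathlib `H1ofAutOnUnitsUnique`,
  at the layer `L/L^U`).
* §2 (any fields, `L/K` cyclic) `toAddSubgroup_range_unitsNorm`, **`natCard_H2_units_eq_index`**:
  `|H²(Gal(L/K), Lˣ)| = (Kˣ : N_{L/K} Lˣ)` (`CyclicExtension.H2UnitsIso`).
* §3 (`K` a non-archimedean local field, `L/K` cyclic) **`natCard_H2_units_eq_finrank`**
  (`= [L:K]`), `…_eq_card` (`= |Gal(L/K)|`), and for every subgroup
  **`natCard_H2_res_units`**: `|H²(U, Lˣ)| = |U|` (the layer `L/L^U` over the local field `L^U`).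
* §4 **`isAddCyclic_quotient_range_unitsNorm`** (`Kˣ/N_{L/K}Lˣ` is cyclic: `≅ Gal(L/K)` by the local
  reciprocity law, through the embedded copy of `L` in `K̄`), **`isAddCyclic_H2_units`**.
* §5 **`exists_isClassModule_units`**: `∃ φ, IsClassModule (Rep.ofAlgebraAutOnUnits K L) φ` for every
  cyclic layer of a non-archimedean local field (the engine's `IsClassModule.of_card`); consequences
  `nonempty_tateIso_units` (TATE'S THEOREM for cyclic local layers), `isZero_groupCohomology_three_res_units`
  (`H³(U, Lˣ) = 0`), `nonempty_reciprocityAddEquiv_units` (`Gal^{ab} ≃ Kˣ/N Lˣ`, abstractly).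

What this is NOT: the fundamental class is not normalised (no invariant `inv = 1/[L:K]`, no
comparison with the engine's unramified class modules `UnramifiedClassModule` or with the norm
residue symbol of `localReciprocityLaw`); non-cyclic layers (the engine's `LocalClassFormation`
template needs the unramified composita `Unramified.HasUnramifiedComposita`, not supplied here).

## References
* J.-P. Serre, *Local Fields*, GTM 67 (1979), XIII §3 Prop. 6 and Cor., §4 Thm. 1, Prop. 9
  (`(Kˣ : N Lˣ) = [L:K]`), X §1 Prop. 2 (Hilbert 90). [SerreLocalFields1979]
* J. Neukirch, *Class Field Theory — The Bonn Lectures* (2013), I §7 Thm. (7.3), II §5 (5.1)–(5.6).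
  [Neukirch2013]
* J. Neukirch, *Algebraic Number Theory* (1999), V §1 Thm. (1.1) (the class field axiom). [NeukirchANT1999]
-/

noncomputable section

open CategoryTheory CategoryTheory.Limits groupCohomology

namespace Literature.NumberTheory.GaloisRepresentations

namespace UnitsLayer

open Literature.Algebra.Homology

/-! ## §1. Any fields: the restriction to `U` is the layer `L/L^U`; axiom I (Hilbert 90) -/

section AnyField

variable (K L : Type) [Field K] [Field L] [Algebra K L] [FiniteDimensional K L]

/-- **`Hⁿ(U, Res_U Lˣ) ≅ Hⁿ(Gal(L/L^U), Lˣ)`**: the restriction of `Rep.ofAlgebraAutOnUnits K L` to a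
subgroup `U ≤ Gal(L/K)` is the units representation of the layer `L/L^U`, transported along
`U ≃* Gal(L/L^U)` (`IntermediateField.subgroupEquivAlgEquiv`; an automorphism acts on `Lˣ` through
its underlying map, which the equivalence does not change). [cite: SerreLocalFields1979, Ch. X §1 (before Prop. 2)] -/
theorem nonempty_groupCohomology_res_iso_fixedField (U : Subgroup (L ≃ₐ[K] L)) (n : ℕ) :
    Nonempty (groupCohomology (Rep.res U.subtype (Rep.ofAlgebraAutOnUnits K L)) n ≅
      groupCohomology (Rep.ofAlgebraAutOnUnits (IntermediateField.fixedField U) L) n) :=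
  ⟨groupCohomology.mapIso (IntermediateField.subgroupEquivAlgEquiv U)
    (@LinearEquiv.refl ℤ (Additive Lˣ) _ _ (AddCommGroup.toIntModule _))
    (fun _ => LinearMap.ext fun _ => congrArg Additive.ofMul (Units.ext rfl)) n⟩

/-- `|Hⁿ(U, Res_U Lˣ)| = |Hⁿ(Gal(L/L^U), Lˣ)|`. [cite: SerreLocalFields1979, Ch. X §1] -/
theorem natCard_groupCohomology_res_units (U : Subgroup (L ≃ₐ[K] L)) (n : ℕ) :
    Nat.card (groupCohomology (Rep.res U.subtype (Rep.ofAlgebraAutOnUnits K L)) n) =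
      Nat.card (groupCohomology (Rep.ofAlgebraAutOnUnits (IntermediateField.fixedField U) L) n) := by
  obtain ⟨I⟩ := nonempty_groupCohomology_res_iso_fixedField K L U n
  exact Nat.card_congr I.toLinearEquiv.toEquiv

/-- **Axiom I for every subgroup: `H¹(U, Lˣ) = 0`** for `L/K` finite Galois and every `U ≤ Gal(L/K)`
— Hilbert's Theorem 90 for the layer `L/L^U` (Mathlib `H1ofAutOnUnitsUnique`), in the shape
`IsClassModule.isZero_H1` of the engine. [cite: SerreLocalFields1979, Ch. X §1 Prop. 2] -/
theorem isZero_H1_res_units (U : Subgroup (L ≃ₐ[K] L)) :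
    IsZero (groupCohomology (Rep.res U.subtype (Rep.ofAlgebraAutOnUnits K L)) 1) := by
  obtain ⟨I⟩ := nonempty_groupCohomology_res_iso_fixedField K L U 1
  haveI : Subsingleton (groupCohomology (Rep.ofAlgebraAutOnUnits (IntermediateField.fixedField U) L) 1) :=
    inferInstance
  exact (ModuleCat.isZero_of_subsingleton _).of_iso I

end AnyField

/-! ## §2. Any fields, `L/K` cyclic: `|H²(Gal(L/K), Lˣ)| = (Kˣ : N_{L/K} Lˣ)` -/

section CyclicAnyField

variable (K L : Type) [Field K] [Field L] [Algebra K L] [FiniteDimensional K L]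

omit [FiniteDimensional K L] in
/-- The range of the engine's additive norm `unitsNorm` is `N_{L/K}(Lˣ)` (written additively).
[cite: SerreLocalFields1979, Ch. XIII §2 Cor. to Prop. 5 (proof)] -/
theorem toAddSubgroup_range_unitsNorm :
    (LinearMap.range (CyclicExtension.unitsNorm K L)).toAddSubgroup =
      Subgroup.toAddSubgroup (Units.map (Algebra.norm K : L →* K)).range := by
  ext a
  rw [Submodule.mem_toAddSubgroup, Additive.mem_toAddSubgroup]
  constructor
  · rintro ⟨x, rfl⟩
    exact ⟨Additive.toMul x, rfl⟩
  · rintro ⟨u, hu⟩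
    exact ⟨Additive.ofMul u, congrArg Additive.ofMul hu⟩

/-- **`|H²(Gal(L/K), Lˣ)| = (Kˣ : N_{L/K} Lˣ)` for `L/K` finite cyclic** (any fields): the engine's
`CyclicExtension.H2UnitsIso : H²(Gal(L/K), Lˣ) ≅ Kˣ/N_{L/K}Lˣ` counted.
[cite: SerreLocalFields1979, Ch. XIII §2 Cor. to Prop. 5 (proof); VIII §4 Cor. to Prop. 6] -/
theorem natCard_H2_units_eq_index [IsGalois K L] [IsCyclic (L ≃ₐ[K] L)] :
    Nat.card (groupCohomology (Rep.ofAlgebraAutOnUnits K L) 2) =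
      (Units.map (Algebra.norm K : L →* K)).range.index := by
  obtain ⟨g, hg⟩ := IsCyclic.exists_generator (α := L ≃ₐ[K] L)
  rw [Nat.card_congr (CyclicExtension.H2UnitsIso K L g hg).toLinearEquiv.toEquiv]
  have h1 : Nat.card (Additive Kˣ ⧸ LinearMap.range (CyclicExtension.unitsNorm K L)) =
      (LinearMap.range (CyclicExtension.unitsNorm K L)).toAddSubgroup.index :=
    (AddSubgroup.index_eq_card _).symm
  change Nat.card (Additive Kˣ ⧸ LinearMap.range (CyclicExtension.unitsNorm K L)) = _
  rw [h1, toAddSubgroup_range_unitsNorm, Subgroup.index_toAddSubgroup]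

end CyclicAnyField

/-! ## §3. `K` a non-archimedean local field: `|H²(U, Lˣ)| = |U|` for every `U`, `L/K` cyclic -/

section LocalField

variable (K : Type) [Field K] [ValuativeRel K] [TopologicalSpace K] [IsNonarchimedeanLocalField K]
variable (L : Type) [Field L] [Algebra K L] [FiniteDimensional K L] [IsGalois K L]

/-- **`|H²(Gal(L/K), Lˣ)| = [L : K]` for a cyclic extension of a non-archimedean local field** —
the local class field axiom `(Kˣ : N_{L/K} Lˣ) = [L:K]` (the tree's
`index_range_unitsMap_norm_eq_finrank`, Neukirch ANT V (1.1)) read on `H² ≅ Kˣ/N Lˣ` (§2).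
[cite: NeukirchANT1999, Ch. V §1 Thm. (1.1)][cite: SerreLocalFields1979, Ch. XIII §4 Prop. 9] -/
theorem natCard_H2_units_eq_finrank [IsCyclic (L ≃ₐ[K] L)] :
    Nat.card (groupCohomology (Rep.ofAlgebraAutOnUnits K L) 2) = Module.finrank K L := by
  rw [natCard_H2_units_eq_index, index_range_unitsMap_norm_eq_finrank K L]

/-- `|H²(Gal(L/K), Lˣ)| = |Gal(L/K)|` for a cyclic extension of a non-archimedean local field.
[cite: NeukirchANT1999, Ch. V §1 Thm. (1.1)] -/
theorem natCard_H2_units_eq_card [IsCyclic (L ≃ₐ[K] L)] :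
    Nat.card (groupCohomology (Rep.ofAlgebraAutOnUnits K L) 2) = Nat.card (L ≃ₐ[K] L) := by
  rw [natCard_H2_units_eq_finrank, IsGalois.card_aut_eq_finrank]

/-- **`|H²(U, Lˣ)| = |U|` for EVERY subgroup `U ≤ Gal(L/K)`, `L/K` a cyclic extension of a
non-archimedean local field** — §3 for the cyclic layer `L/L^U` over the intermediate field `L^U`,
which is again a non-archimedean local field (`FiniteExtension.isNonarchimedeanLocalField`);
hypothesis II of Neukirch's form (7.3) of Tate's theorem for `A = Lˣ`.
[cite: Neukirch2013, Part I §7 Thm. (7.3)][cite: NeukirchANT1999, Ch. V §1 Thm. (1.1)] -/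
theorem natCard_H2_res_units [IsCyclic (L ≃ₐ[K] L)] (U : Subgroup (L ≃ₐ[K] L)) :
    Nat.card (groupCohomology (Rep.res U.subtype (Rep.ofAlgebraAutOnUnits K L)) 2) = Nat.card U := by
  letI := FiniteExtension.valuativeRel K (IntermediateField.fixedField U)
  letI := FiniteExtension.topologicalSpace K (IntermediateField.fixedField U)
  haveI := FiniteExtension.isNonarchimedeanLocalField K (IntermediateField.fixedField U)
  haveI : IsGalois (IntermediateField.fixedField U) L :=
    IsGalois.tower_top_of_isGalois K (IntermediateField.fixedField U) L
  haveI : IsCyclic (L ≃ₐ[IntermediateField.fixedField U] L) :=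
    isCyclic_of_surjective (IntermediateField.subgroupEquivAlgEquiv U)
      (IntermediateField.subgroupEquivAlgEquiv U).surjective
  rw [natCard_groupCohomology_res_units,
    natCard_H2_units_eq_card (IntermediateField.fixedField U) L,
    ← Nat.card_congr (IntermediateField.subgroupEquivAlgEquiv U).toEquiv]

/-! ## §4. `Kˣ/N_{L/K}Lˣ` and `H²(Gal(L/K), Lˣ)` are cyclic (local reciprocity law) -/

/-- **`Kˣ / N_{L/K} Lˣ` is cyclic for a cyclic extension of a non-archimedean local field** (written
additively, on the engine's quotient `Additive Kˣ ⧸ range unitsNorm`): by the local reciprocity law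
(the tree's `localReciprocityLaw_holds`, Serre XIII §4: the norm residue symbol `Kˣ → Gal(E/K)` is
onto with kernel `N_{E/K} Eˣ`) for the embedded copy `E ≅ L` of `L` in `K̄`, `Kˣ/N_{L/K}Lˣ ≅ Gal(L/K)`.
[cite: SerreLocalFields1979, Ch. XIII §4 Thm. 1 and Cor. to Prop. 8] -/
theorem isAddCyclic_quotient_range_unitsNorm [IsCyclic (L ≃ₐ[K] L)] :
    IsAddCyclic (Additive Kˣ ⧸ LinearMap.range (CyclicExtension.unitsNorm K L)) := by
  classical
  haveI : IsAbelianGalois K L := IsAbelianGalois.of_isCyclic K L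
  obtain ⟨θ, hθ⟩ := localReciprocityLaw_holds K
  obtain ⟨hsurj, hker, -⟩ := hθ (embeddedField K L)
  -- the norm groups of `L` and of its embedded copy coincide
  have hrange : (Units.map (Algebra.norm K : embeddedField K L →* K)).range =
      (Units.map (Algebra.norm K : L →* K)).range := by
    ext a
    constructor
    · rintro ⟨u, rfl⟩
      refine ⟨Units.map ((embeddedEquiv K L).symm : embeddedField K L →* L) u, Units.ext ?_⟩
      change Algebra.norm K ((embeddedEquiv K L).symm (u : embeddedField K L)) =
        Algebra.norm K (u : embeddedField K L)
      exact Algebra.norm_eq_of_algEquiv (embeddedEquiv K L).symm _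
    · rintro ⟨u, rfl⟩
      refine ⟨Units.map ((embeddedEquiv K L) : L →* embeddedField K L) u, Units.ext ?_⟩
      change Algebra.norm K ((embeddedEquiv K L) (u : L)) = Algebra.norm K (u : L)
      exact Algebra.norm_eq_of_algEquiv (embeddedEquiv K L) _
  -- `Kˣ / N Lˣ ≅ Gal(E/K) ≅ Gal(L/K)` is cyclic
  haveI : IsCyclic (embeddedField K L ≃ₐ[K] embeddedField K L) :=
    isCyclic_of_surjective (embeddedEquiv K L).autCongr (embeddedEquiv K L).autCongr.surjective
  have e : Kˣ ⧸ (Units.map (Algebra.norm K : L →* K)).range ≃*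
      (embeddedField K L ≃ₐ[K] embeddedField K L) :=
    (QuotientGroup.quotientMulEquivOfEq (hker.trans hrange)).symm.trans
      (QuotientGroup.quotientKerEquivOfSurjective _ hsurj)
  haveI : IsCyclic (Kˣ ⧸ (Units.map (Algebra.norm K : L →* K)).range) :=
    isCyclic_of_surjective e.symm e.symm.surjective
  -- the projection `Kˣ → Additive Kˣ ⧸ range unitsNorm` factors through `Kˣ / N Lˣ`, onto
  let f : Kˣ →* Multiplicative (Additive Kˣ ⧸ LinearMap.range (CyclicExtension.unitsNorm K L)) :=
    AddMonoidHom.toMultiplicativeRight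
      (LinearMap.range (CyclicExtension.unitsNorm K L)).mkQ.toAddMonoidHom
  have hf_apply : ∀ x : Kˣ, f x = Multiplicative.ofAdd
      ((LinearMap.range (CyclicExtension.unitsNorm K L)).mkQ (Additive.ofMul x)) := fun _ => rfl
  have hf_ker : (Units.map (Algebra.norm K : L →* K)).range ≤ f.ker := by
    rintro x ⟨u, rfl⟩
    rw [MonoidHom.mem_ker, hf_apply, ← ofAdd_zero]
    congr 1
    rw [Submodule.mkQ_apply, Submodule.Quotient.mk_eq_zero]
    exact ⟨Additive.ofMul u, rfl⟩
  have hlift_surj : Function.Surjective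
      (QuotientGroup.lift (Units.map (Algebra.norm K : L →* K)).range f hf_ker) := by
    intro q
    induction q using Submodule.Quotient.induction_on with
    | H a =>
      exact ⟨((Additive.toMul a : Kˣ) : Kˣ ⧸ (Units.map (Algebra.norm K : L →* K)).range),
        QuotientGroup.lift_mk _ hf_ker (Additive.toMul a)⟩
  exact isCyclic_multiplicative_iff.1 (isCyclic_of_surjective _ hlift_surj)

/-- **`H²(Gal(L/K), Lˣ)` is cyclic for a cyclic extension of a non-archimedean local field**
(`H² ≅ Kˣ/N Lˣ`, `CyclicExtension.H2UnitsIso`, and §4).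
[cite: SerreLocalFields1979, Ch. XIII §3 Prop. 6 and §4 Thm. 1] -/
theorem isAddCyclic_H2_units [IsCyclic (L ≃ₐ[K] L)] :
    IsAddCyclic (groupCohomology (Rep.ofAlgebraAutOnUnits K L) 2) := by
  obtain ⟨g, hg⟩ := IsCyclic.exists_generator (α := L ≃ₐ[K] L)
  haveI := isAddCyclic_quotient_range_unitsNorm K L
  let e : (Additive Kˣ ⧸ LinearMap.range (CyclicExtension.unitsNorm K L)) ≃ₗ[ℤ]
      groupCohomology (Rep.ofAlgebraAutOnUnits K L) 2 :=
    (CyclicExtension.H2UnitsIso K L g hg).symm.toLinearEquiv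
  exact isAddCyclic_of_surjective e e.surjective

/-! ## §5. Every cyclic layer of a non-archimedean local field is a class module (Tate's theorem) -/

/-- **Every CYCLIC layer `(Gal(L/K), Lˣ)` of a non-archimedean local field is a class module**: there
is a 2-cocycle `φ` (a generator `[φ]` of the cyclic group `H²(Gal(L/K), Lˣ) = Br(L/K)` of order
`[L:K]`) with `IsClassModule (Rep.ofAlgebraAutOnUnits K L) φ` — I. `H¹(U, Lˣ) = 0` (Hilbert 90, §1),
II. `|H²(U, Lˣ)| = |U|` for every `U` (§3), and `[φ]` of order `|Gal(L/K)|` (§4), by Neukirch's form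
of Tate's theorem (the engine's `IsClassModule.of_card`). The generator is not normalised here.
[cite: SerreLocalFields1979, Ch. XIII §3 Prop. 6, §4 Thm. 1][cite: Neukirch2013, Part I §7 Thm. (7.3)] -/
theorem exists_isClassModule_units [IsCyclic (L ≃ₐ[K] L)] :
    ∃ φ : cocycles₂ (Rep.ofAlgebraAutOnUnits K L), IsClassModule (Rep.ofAlgebraAutOnUnits K L) φ := by
  haveI := isAddCyclic_H2_units K L
  obtain ⟨x, hx⟩ :=
    IsAddCyclic.exists_ofOrder_eq_natCard (α := groupCohomology (Rep.ofAlgebraAutOnUnits K L) 2)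
  obtain ⟨φ, rfl⟩ : ∃ φ : cocycles₂ (Rep.ofAlgebraAutOnUnits K L),
      H2π (Rep.ofAlgebraAutOnUnits K L) φ = x := by
    induction x using H2_induction_on with
    | h φ => exact ⟨φ, rfl⟩
  exact ⟨φ, IsClassModule.of_card (isZero_H1_res_units K L) (natCard_H2_res_units K L)
    (by rw [hx, natCard_H2_units_eq_card])⟩

/-- **Tate's theorem for cyclic layers of a local field: `Ĥⁿ(U, ℤ) ≅ Ĥⁿ⁺²(U, Lˣ)`** for every
`n ∈ ℤ` and every `U ≤ Gal(L/K)` (the engine's `IsClassModule.tateIso`, Lang's `δ ∘ δ`).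
[cite: Neukirch2013, Part I §7 Thm. (7.3)][cite: SerreLocalFields1979, Ch. XIII §4 Thm. 1] -/
theorem nonempty_tateIso_units [IsCyclic (L ≃ₐ[K] L)] (U : Subgroup (L ≃ₐ[K] L)) [Fintype U] (n : ℤ) :
    Nonempty (tateCohomology (Rep.res U.subtype (Rep.trivial ℤ (L ≃ₐ[K] L) ℤ)) n ≅
      tateCohomology (Rep.res U.subtype (Rep.ofAlgebraAutOnUnits K L)) (n + 2)) := by
  obtain ⟨φ, hA⟩ := exists_isClassModule_units K L
  exact hA.nonempty_tateIso U n

/-- **`H³(U, Lˣ) = 0`** for every subgroup `U ≤ Gal(L/K)` of a cyclic layer of a local field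
(`≅ H¹(U, ℤ) = 0`). [cite: Neukirch2013, Part II §1 Cor. (1.8)] -/
theorem isZero_groupCohomology_three_res_units [IsCyclic (L ≃ₐ[K] L)] (U : Subgroup (L ≃ₐ[K] L)) :
    IsZero (groupCohomology (Rep.res U.subtype (Rep.ofAlgebraAutOnUnits K L)) 3) := by
  obtain ⟨φ, hA⟩ := exists_isClassModule_units K L
  exact hA.isZero_groupCohomology_three_res U

/-- **The abstract reciprocity isomorphism `Gal(L/K)^{ab} ≃ (Lˣ)^G/N_G Lˣ = Kˣ/N_{L/K}Lˣ`** of a cyclic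
layer of a local field (Tate's theorem at `n = -2`, the engine's `IsClassModule.reciprocityAddEquiv`;
NOT asserted here to be the norm residue symbol — the generator is not normalised).
[cite: Neukirch2013, Part I §7 (remark after Thm. (7.3))][cite: SerreLocalFields1979, Ch. XIII §4 Thm. 1] -/
theorem nonempty_reciprocityAddEquiv_units [IsCyclic (L ≃ₐ[K] L)] :
    Nonempty (Additive (Abelianization (L ≃ₐ[K] L)) ≃+ NormResidue (Rep.ofAlgebraAutOnUnits K L)) := by
  obtain ⟨φ, hA⟩ := exists_isClassModule_units K L
  exact ⟨hA.reciprocityAddEquiv⟩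

end LocalField

end UnitsLayer

end Literature.NumberTheory.GaloisRepresentations

end
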